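import Literature.NumberTheory.EllipticCurves.IsogenyClassFiniteProofs
import Literature.NumberTheory.EllipticCurves.IsogenyCompProofs
import Literature.NumberTheory.EllipticCurves.IsogenyIdProofs
import Literature.NumberTheory.EllipticCurves.BSDInvariantsProofs
import Literature.NumberTheory.EllipticCurves.ComplexMultiplicationBurungaleFlachProofs
import Mathlib.NumberTheory.Padics.PadicVal.Basic
import HarnessLib

/-!
# Registered stub `stub_maxPeriodWitness` of line `kato-free-lower-sandwich-two` (skeleton v4) PROVED — crux
# `OrdMissingLowerBoundAtTwo` (stmt-BirchSwinnertonDyer-19577, route `ByReductionTypeAtTwo`; lead `cruxlead-…-19577` g0; `--supports`)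

HONEST FRAMING.  THEOREMS ONLY; no definition, no named fact, no `sorry`; BSD is not proved by any of this and the crux
19577 is not closed here.  This is the canonical-member SELECTOR of the line: every elliptic, globally minimal `W/ℚ` is
ℚ-isogenous to a globally minimal `W″` whose real Néron period `Ω(W″)` is **2-adically maximal in the isogeny class** —
whenever `W₃ ∼ W″` is globally minimal and `Ω(W₃) = q·Ω(W″)` (`q ∈ ℚ`), `v₂(q) ≤ 0`.  (By the period-jump law at `2`
this is the «plateau» member — no rational `2`-torsion point both ramified at `2` and odd — of Greenberg LNM 1716 §5 /
Dokchitser–Dokchitser 2015; that dictionary is not needed and not proved here.)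

PROOF (no modularity, no Vélu).  By Shafarevich–Silverman *AEC* IX.6.2 (tree THEOREM
`WeierstrassCurve.finite_isogenyClass_holds`) the curves ℚ-isogenous to `W` meet finitely many ℚ-isomorphism classes:
a finite set `F` of models with `C • W' ∈ F` for every elliptic `W' ∼ W`.  Two GLOBALLY MINIMAL models in one
ℚ-isomorphism class have the same real period (`realPeriodRat_variableChange_of_isGloballyMinimal_holds`, `u = ±1`), so
the real periods of the globally minimal members form a FINITE set of positive reals (`realPeriods_finite`; positivity `realPeriodRat_pos_holds`), hence so do
the RATIOS `q = Ω(W')/Ω(W)` that occur (`periodRatios_finite`; `q = 1` occurs).  A ratio `q₀` of maximal `2`-adic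
valuation, realised by `W″`, is the witness: for `W₃ ∼ W″` globally minimal with `Ω(W₃) = q·Ω(W″)` the ratio `q·q₀`
occurs (`W₃ ∼ W` by transitivity), so `v₂(q·q₀) ≤ v₂(q₀)`, i.e. `v₂(q) ≤ 0` (`q₀ > 0`; `q = 0` is trivial).

References: J. H. Silverman, *AEC* 2nd ed., Cor. IX.6.2, VIII.8.3; A. W. Knapp, *Elliptic Curves*, Thm. 10.3;
R. Greenberg, LNM 1716 (1999), §5; T. and V. Dokchitser, *Local invariants of isogenous elliptic curves*,
Trans. AMS 367 (2015), §7.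
-/

set_option autoImplicit false
-- the sub-problem namespace repeats the summit name by design (D-0017 nested layout)
set_option linter.dupNamespace false

noncomputable section

open scoped Classical

open WeierstrassCurve

namespace Summit.BirchSwinnertonDyer.BirchSwinnertonDyer.Theorems.KatoFreeSandwich

section MaxPeriod

variable (W : WeierstrassCurve ℚ) [W.IsElliptic] [W.IsGloballyMinimal]

omit [W.IsGloballyMinimal] in
/-- **The real periods of the globally minimal members of a ℚ-isogeny class form a finite set** (Shafarevich–Silverman
*AEC* IX.6.2 `finite_isogenyClass_holds` + `Ω` is the same for two globally minimal models in one ℚ-isomorphism class,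
`realPeriodRat_variableChange_of_isGloballyMinimal_holds`). [cite: SilvermanAEC2009, Cor. IX.6.2 and VIII.8.3] -/
theorem realPeriods_finite :
    {x : ℝ | ∃ (W' : WeierstrassCurve ℚ) (_ : W'.IsElliptic) (_ : W'.IsGloballyMinimal),
      IsIsogenous W W' ∧ x = W'.realPeriodRat}.Finite := by
  obtain ⟨F, hF⟩ := (finite_isogenyClass_iff W).mp (finite_isogenyClass_holds W)
  -- the periods of the globally minimal models ℚ-isomorphic to a fixed model `W₀` form a subsingleton
  let T : WeierstrassCurve ℚ → Set ℝ := fun W₀ =>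
    {x : ℝ | ∃ (W' : WeierstrassCurve ℚ) (_ : W'.IsElliptic) (_ : W'.IsGloballyMinimal),
      (∃ C : VariableChange ℚ, C • W' = W₀) ∧ x = W'.realPeriodRat}
  have hT : ∀ W₀, (T W₀).Subsingleton := by
    rintro W₀ x ⟨W₁, hE₁, hM₁, ⟨C₁, hC₁⟩, rfl⟩ y ⟨W₂, hE₂, hM₂, ⟨C₂, hC₂⟩, rfl⟩
    -- `W₂ = (C₂⁻¹ * C₁) • W₁`, both globally minimal
    have h12 : (C₂⁻¹ * C₁) • W₁ = W₂ := by rw [mul_smul, hC₁, ← hC₂, inv_smul_smul]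
    haveI : ((C₂⁻¹ * C₁) • W₁).IsGloballyMinimal := by rw [h12]; exact hM₂
    have h := realPeriodRat_variableChange_of_isGloballyMinimal_holds W₁ (C₂⁻¹ * C₁)
    rw [h12] at h
    exact h.symm
  refine ((F.finite_toSet.biUnion fun W₀ _ => (hT W₀).finite)).subset ?_
  rintro x ⟨W', hE', hM', hiso, rfl⟩
  obtain ⟨C, hC⟩ := @hF W' hE' hiso
  exact Set.mem_biUnion (Finset.mem_coe.mpr hC) ⟨W', hE', hM', ⟨C, rfl⟩, rfl⟩

omit [W.IsGloballyMinimal] in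
/-- **The period ratios `Ω(W')/Ω(W)` realised by globally minimal members `W'` of the class of `W` form a finite set of
rationals** (those that happen to be rational; `q ↦ q·Ω(W)` is injective since `Ω(W) > 0`). [folklore] -/
theorem periodRatios_finite :
    {q : ℚ | ∃ (W' : WeierstrassCurve ℚ) (_ : W'.IsElliptic) (_ : W'.IsGloballyMinimal),
      IsIsogenous W W' ∧ W'.realPeriodRat = (q : ℝ) * W.realPeriodRat}.Finite := by
  have hΩ : 0 < W.realPeriodRat := W.realPeriodRat_pos_holds
  have hsub : {q : ℚ | ∃ (W' : WeierstrassCurve ℚ) (_ : W'.IsElliptic) (_ : W'.IsGloballyMinimal),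
      IsIsogenous W W' ∧ W'.realPeriodRat = (q : ℝ) * W.realPeriodRat} ⊆
      (fun q : ℚ => (q : ℝ) * W.realPeriodRat) ⁻¹'
        {x : ℝ | ∃ (W' : WeierstrassCurve ℚ) (_ : W'.IsElliptic) (_ : W'.IsGloballyMinimal),
          IsIsogenous W W' ∧ x = W'.realPeriodRat} := by
    rintro q ⟨W', hE', hM', hiso, hq⟩
    exact ⟨W', hE', hM', hiso, hq.symm⟩
  refine Set.Finite.subset (Set.Finite.preimage ?_ (realPeriods_finite W)) hsub
  intro a _ b _ hab
  have h : (a : ℝ) = b := mul_right_cancel₀ hΩ.ne' hab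
  exact_mod_cast h

/-- **Registered stub `stub_maxPeriodWitness` of line `kato-free-lower-sandwich-two` (skeleton v4), VERBATIM:** every
elliptic, globally minimal `W/ℚ` is ℚ-isogenous to a globally minimal `W″` whose real Néron period is 2-adically MAXIMAL
in the isogeny class — if `W₃ ∼ W″` is globally minimal and `Ω(W₃) = q·Ω(W″)` with `q ∈ ℚ`, then `v₂(q) ≤ 0`.  Proof:
a ratio `q₀ = Ω(W″)/Ω(W)` of maximal `2`-adic valuation in the finite set `periodRatios_finite` (non-empty: `q = 1` at
`W` itself); then `q·q₀` is again a realised ratio (`W₃ ∼ W`), so `v₂(q) + v₂(q₀) ≤ v₂(q₀)`.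
[cite: SilvermanAEC2009, Cor. IX.6.2] [cite: GreenbergLNM1716, §5 p. 179 (the maximal-period / plateau member; shape only)] -/
theorem stub_maxPeriodWitness : ∀ (W : WeierstrassCurve ℚ) [W.IsElliptic] [W.IsGloballyMinimal],
    ∃ (W'' : WeierstrassCurve ℚ) (_ : W''.IsElliptic) (_ : W''.IsGloballyMinimal),
      IsIsogenous W W'' ∧
      (∀ (W₃ : WeierstrassCurve ℚ) [W₃.IsElliptic] [W₃.IsGloballyMinimal], IsIsogenous W'' W₃ →
        ∀ q : ℚ, W₃.realPeriodRat = (q : ℝ) * W''.realPeriodRat → padicValRat 2 q ≤ 0) := by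
  intro W _ _
  have hΩ : 0 < W.realPeriodRat := W.realPeriodRat_pos_holds
  set S : Set ℚ := {q : ℚ | ∃ (W' : WeierstrassCurve ℚ) (_ : W'.IsElliptic) (_ : W'.IsGloballyMinimal),
      IsIsogenous W W' ∧ W'.realPeriodRat = (q : ℝ) * W.realPeriodRat} with hS_def
  have hS : S.Finite := periodRatios_finite W
  have h1 : (1 : ℚ) ∈ hS.toFinset := by
    rw [Set.Finite.mem_toFinset]
    exact ⟨W, ‹_›, ‹_›, isIsogenous_self W, by simp⟩
  obtain ⟨q₀, hq₀S, hmax⟩ := hS.toFinset.exists_max_image (fun q => padicValRat 2 q) ⟨1, h1⟩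
  rw [Set.Finite.mem_toFinset] at hq₀S
  obtain ⟨W'', hE'', hM'', hiso'', hq₀⟩ := hq₀S
  -- `q₀ > 0`
  have hq₀pos : (0 : ℝ) < q₀ := by
    have h'' : 0 < W''.realPeriodRat := W''.realPeriodRat_pos_holds
    rw [hq₀] at h''
    exact (mul_pos_iff_of_pos_right hΩ).mp h''
  have hq₀ne : q₀ ≠ 0 := by
    rintro rfl
    simp at hq₀pos
  refine ⟨W'', hE'', hM'', hiso'', fun W₃ _ _ hiso₃ q hq => ?_⟩
  by_cases hq0 : q = 0
  · rw [hq0, padicValRat.zero]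
  -- the ratio `q·q₀` is realised by `W₃ ∼ W`
  have hmem : q * q₀ ∈ hS.toFinset := by
    rw [Set.Finite.mem_toFinset]
    refine ⟨W₃, ‹_›, ‹_›, hiso''.trans' hiso₃, ?_⟩
    rw [hq, hq₀]; push_cast; ring
  have hle := hmax (q * q₀) hmem
  haveI : Fact (Nat.Prime 2) := ⟨Nat.prime_two⟩
  rw [padicValRat.mul hq0 hq₀ne] at hle
  linarith

end MaxPeriod

end Summit.BirchSwinnertonDyer.BirchSwinnertonDyer.Theorems.KatoFreeSandwich

end
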